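/-
Copyright (c) 2026. All rights reserved.
Released under Apache 2.0 license as described in the file LICENSE.
Authors: abc-iut cell, prover seat abc-iut-L4-t12 (gen 8).
-/
import Literature.AnabelianGeometry.AbsoluteAnabelian.ArchimedeanHolFieldFunctorGeometricOverIdRigidTripod
import Literature.Analysis.Complex.PuncturedPlaneAutomorphisms
import HarnessLib

/-!
# [AbsTopIII] Prop 4.2 (i), geometric column: automorphisms of `ℂ ∖ F` in `HolRS` are Möbius

PROOF-ONLY junction file (abc-iut cell, campaign-L item R1.2 of the `EA` column of [AbsTopIII]
Prop 4.2 / Cor 4.5; classical).  The cell's per-object residual at an object `𝕏` of abc-iut-L4-t14's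
geometric model `HolRS` is (H1′) «an automorphism `σ` of `𝕏` acting trivially on the slice `Over 𝕏`
is the identity» (abc-iut-w5-d144, `ArchimedeanHolFieldFunctorGeometricGaloisDescent`); at
`𝕏 = ℂ ∖ F` the proposed route ends with «`σ` fixes every puncture ⇒ `σ = id`».  This file reads the
classical classification `Literature.Analysis.Complex.PuncturedPlane.exists_moebius` (biholomorphisms
of finitely punctured planes are Möbius transformations; Conway, *Functions of One Complex Variable I*,
Ch. V Thm. 1.21 with Ch. III §3) through the junction `HolRS.exists_mem_holAut_of_iso` of
`ArchimedeanHolFieldFunctorGeometricOverIdRigidTripod`: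

* `HolRS.planeComplFinite_iso_moebius` — every automorphism of `ℂ ∖ F` (`F` finite) in `HolRS` is
  `z ↦ (A z + B)/(C z + D)`, `A D - B C ≠ 0`;
* `HolRS.planeComplFinite_iso_eq_id_of_tendsto` — for `F` with two distinct points, an automorphism
  `a` of `ℂ ∖ F` in `HolRS` with `a(x) → p` as `x → p` for every `p ∈ F` (it «fixes every puncture»)
  is the identity — stated intrinsically (`Filter.comap Subtype.val (𝓝[≠] p)` on the carrier), no
  ambient representative needed by the consumer.

HONEST SCOPE: model level; this is the analytic half of (H1′) at `ℂ ∖ F` — the cover-theoretic half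
«`Over.map σ ≅ 𝟭 ⇒ σ` fixes every puncture» is NOT proved here; nothing bears on [IUTchIII] Cor. 3.12;
model ≠ reconstruction; support library, not a node.  No definitions.

## References

* S. Mochizuki, *Topics in Absolute Anabelian Geometry III*, kurims ms, proof of Prop 4.2 (i) p.106
  l.11–19. [MochizukiAbsTopIII2015]
* J. B. Conway, *Functions of One Complex Variable I*, GTM 11 (1978), Ch. V Thm. 1.21. [Conway1978]
-/

noncomputable section

open CategoryTheory Set Filter Topology TopologicalSpace
open scoped Manifold ContDiff
open Literature.Analysis.Complex

namespace Literature.AnabelianGeometry.AbsoluteAnabelian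

namespace HolRS

variable {F : Set ℂ} (hF : F.Finite)

/-- The carrier set of `planeComplFinite F` is `Fᶜ`. [cite: MochizukiAbsTopIII2015, Definition 4.1 (i) p.101] -/
theorem coe_opens_planeComplFinite :
    ((⟨Fᶜ, hF.isClosed.isOpen_compl⟩ : Opens ℂ) : Set ℂ) = Fᶜ := rfl

/-- **Every automorphism of `ℂ ∖ F` (`F` finite) in `HolRS` is a Möbius transformation.**
[cite: Conway1978, Ch. V Thm. 1.21] [cite: MochizukiAbsTopIII2015, Proposition 4.2 (i) p.106] -/
theorem planeComplFinite_iso_moebius (a : planeComplFinite F hF ≅ planeComplFinite F hF) :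
    ∃ A B C D : ℂ, A * D - B * C ≠ 0 ∧
      ∀ x : (⟨Fᶜ, hF.isClosed.isOpen_compl⟩ : Opens ℂ),
        C * x + D ≠ 0 ∧ Subtype.val (a.hom.toFun x) = (A * x + B) / (C * x + D) := by
  classical
  obtain ⟨φ, hφ, hφa, -⟩ := exists_mem_holAut_of_iso _ (isConnected_compl_finite hF) a
  obtain ⟨A, B, C, D, hdet, h⟩ := PuncturedPlane.exists_moebius_of_mem_holAut
    (coe_opens_planeComplFinite hF) hF hφ (f := fun z => if h : z ∈ Fᶜ then
      ((φ ⟨z, h⟩ : (⟨Fᶜ, hF.isClosed.isOpen_compl⟩ : Opens ℂ)) : ℂ) else 0)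
    (fun x => by simp only [dif_pos (show (x : ℂ) ∈ Fᶜ from x.2)])
  refine ⟨A, B, C, D, hdet, fun x => ⟨(h x).1, ?_⟩⟩
  rw [← hφa]
  exact (h x).2

/-- **An automorphism of `ℂ ∖ F` in `HolRS` that fixes every puncture is the identity** (`F` finite
with two distinct points `p₁ ≠ p₂`): if for every `p ∈ F`, `a(x) → p` as `x → p` in `ℂ ∖ F`, then
`a = 𝟙`.  Intrinsic form of `PuncturedPlane.eq_id_of_forall_tendsto` (every such `a` is Möbius, fixes
the end `∞` as well, hence is affine fixing `p₁, p₂`).  This is the analytic step «σ fixes the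
punctures pointwise ⇒ σ = id» of the (H1′) argument at `ℂ ∖ F`.
[cite: Conway1978, Ch. V Thm. 1.21] [cite: MochizukiAbsTopIII2015, Proposition 4.2 (i) p.106] -/
theorem planeComplFinite_iso_eq_id_of_tendsto {p₁ p₂ : ℂ} (hp₁ : p₁ ∈ F) (hp₂ : p₂ ∈ F)
    (hp : p₁ ≠ p₂) (a : planeComplFinite F hF ≅ planeComplFinite F hF)
    (hfix : ∀ p ∈ F, Tendsto (fun x : (⟨Fᶜ, hF.isClosed.isOpen_compl⟩ : Opens ℂ) =>
      Subtype.val (a.hom.toFun x)) (comap Subtype.val (𝓝[≠] p)) (𝓝 p)) :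
    a.hom = 𝟙 _ := by
  classical
  set U : Opens ℂ := ⟨Fᶜ, hF.isClosed.isOpen_compl⟩ with hUdef
  have hU : (U : Set ℂ) = Fᶜ := rfl
  obtain ⟨φ, hφ, hφa, -⟩ := exists_mem_holAut_of_iso U (isConnected_compl_finite hF) a
  -- an ambient representative of `φ`
  let f : ℂ → ℂ := fun z => if h : z ∈ U then (φ ⟨z, h⟩ : ℂ) else 0
  have hf : ∀ x : U, (φ x : ℂ) = f x := fun x => by simp only [f, dif_pos x.2]
  -- the intrinsic hypothesis gives `f → p` along `𝓝[≠] p`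
  have hfix' : ∀ p ∈ F, Tendsto f (𝓝[≠] p) (𝓝 p) := by
    intro p hpF
    have hmem : (U : Set ℂ) ∈ 𝓝[≠] p := PuncturedPlane.eventually_mem_nhdsNE hU hF
    have hmap : map (Subtype.val : U → ℂ) (comap Subtype.val (𝓝[≠] p)) = 𝓝[≠] p :=
      map_comap_of_mem (by rwa [Subtype.range_coe])
    have h1 : Tendsto (f ∘ (Subtype.val : U → ℂ)) (comap Subtype.val (𝓝[≠] p)) (𝓝 p) := by
      refine (hfix p hpF).congr fun x => ?_
      change Subtype.val (a.hom.toFun x) = f x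
      rw [← hf x, hφa]
    rw [← hmap]
    exact tendsto_map' h1
  have key := PuncturedPlane.eq_id_of_forall_tendsto hU hF hp₁ hp₂ hp ((mem_holAut_iff φ).mp hφ).1
    hf hfix'
  apply hom_ext
  rw [id_toFun, ← hφa]
  funext x
  exact key x

end HolRS

end Literature.AnabelianGeometry.AbsoluteAnabelian
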